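import Summits.CriticalPhenomena.PercolationContinuityZ3.Theorems.PercNearOneGluingNoHeavyLowerTailForestRayleighTreewidthTwo
import HarnessLib

/-!
# Weighted forest negative correlation on graphs of tree-width ≤ 2 — X: positive correlation of connection events (Theorem A of the programme, unconditional on tree-width ≤ 2)

From the Rayleigh inequality `forestsW_rayleigh_of_elimOrder` (weighted forest negative
correlation = Semple–Welsh independence correlation on every minor of an edge system `T` of
tree-width ≤ 2) we derive

* `forestsW_connMonotone_of_elimOrder`: connection probabilities of the weighted spanning-forest
  measure (arboreal gas) of every minor `⟨D ∪ K⟩/K` of `T` are nondecreasing under pinning an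
  extra edge `f` — for every pair `a, b` with `a = b` or `ab ∈ T` (the hypothesis `hmono` of
  `ConnMonotone.forestsW_conn_posCorr_of_connMonotone_on`, via `Z(D;K)[a ≁ b] = Z(D;K ∪ ab)`);
* `forestsW_conn_posCorr_of_elimOrder`: **positive correlation of connection events in the
  arboreal gas with arbitrary activities**, `Z[a~b]·Z[c~d] ≤ Z·Z[a~b ∧ c~d]`, on every minor of
  `T`, for all pairs with `ab, cd ∈ T` (memo KCLUSTER-gen86 Theorem A, now unconditional on the
  class tree-width ≤ 2 ⊇ series–parallel graphs; new as far as we know — conn–conn positive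
  correlation for the arboreal gas is not in print, cf. Bauerschmidt–Helmuth survey §5).

§1 repeats the abstract Harris-type induction of `…ForestConnMonotoneWeighted` with the
influence hypothesis required only for DISJOINT free/pinned pairs (the only case the induction
uses). Theorems only; no definitions, no `sorry`.
-/

open Finset SimpleGraph

namespace Summit.CriticalPhenomena.PercolationContinuityZ3.Theorems.ForestRayleigh

/-! ### §1 The abstract induction with disjoint hypotheses -/

section Abstract

variable {α : Type*} [DecidableEq α]

/-- **Monotone influences imply positive correlation — weighted, relative to `E₀`, hypotheses for
disjoint free/pinned pairs only.** Same statement and proof as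
`ConnMonotone.sum_mul_sum_inter_ge_of_monotone_on`, except that the influence hypotheses `hU`,
`hW` are only required when `D ∩ K = ∅`. [Harris-type induction] -/
theorem sum_mul_sum_inter_ge_of_monotone_on_disjoint (w : α → ℝ) (hw : ∀ a, 0 ≤ w a) (E₀ : Finset α)
    (P U W : Finset α → Prop) [DecidablePred P] [DecidablePred U] [DecidablePred W]
    (hU : ∀ (D K : Finset α) (f : α), f ∉ D → f ∉ K → Disjoint D K → D ∪ insert f K ⊆ E₀ →
      (∑ G ∈ D.powerset.filter (fun G => P (G ∪ K) ∧ U (G ∪ K)), ∏ g ∈ G, w g) *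
          (∑ G ∈ D.powerset.filter (fun G => P (G ∪ insert f K)), ∏ g ∈ G, w g) ≤
        (∑ G ∈ D.powerset.filter (fun G => P (G ∪ insert f K) ∧ U (G ∪ insert f K)), ∏ g ∈ G, w g) *
          (∑ G ∈ D.powerset.filter (fun G => P (G ∪ K)), ∏ g ∈ G, w g))
    (hW : ∀ (D K : Finset α) (f : α), f ∉ D → f ∉ K → Disjoint D K → D ∪ insert f K ⊆ E₀ →
      (∑ G ∈ D.powerset.filter (fun G => P (G ∪ K) ∧ W (G ∪ K)), ∏ g ∈ G, w g) *
          (∑ G ∈ D.powerset.filter (fun G => P (G ∪ insert f K)), ∏ g ∈ G, w g) ≤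
        (∑ G ∈ D.powerset.filter (fun G => P (G ∪ insert f K) ∧ W (G ∪ insert f K)), ∏ g ∈ G, w g) *
          (∑ G ∈ D.powerset.filter (fun G => P (G ∪ K)), ∏ g ∈ G, w g))
    (D K : Finset α) (hDK : Disjoint D K) (hE : D ∪ K ⊆ E₀) :
    (∑ G ∈ D.powerset.filter (fun G => P (G ∪ K) ∧ U (G ∪ K)), ∏ g ∈ G, w g) *
        (∑ G ∈ D.powerset.filter (fun G => P (G ∪ K) ∧ W (G ∪ K)), ∏ g ∈ G, w g) ≤
      (∑ G ∈ D.powerset.filter (fun G => P (G ∪ K)), ∏ g ∈ G, w g) *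
        (∑ G ∈ D.powerset.filter (fun G => P (G ∪ K) ∧ (U (G ∪ K) ∧ W (G ∪ K))), ∏ g ∈ G, w g) := by
  obtain ⟨n, hn⟩ : ∃ n, D.card = n := ⟨_, rfl⟩
  induction n generalizing D K with
  | zero =>
    have hD : D = ∅ := Finset.card_eq_zero.1 hn
    subst hD
    simp only [Finset.powerset_empty, Finset.filter_singleton, Finset.empty_union]
    by_cases hP : P K <;> by_cases hU' : U K <;> by_cases hW' : W K <;> simp [hP, hU', hW']
  | succ n ih =>
    obtain ⟨f, hf⟩ : D.Nonempty := Finset.card_pos.1 (by omega)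
    have hfK : f ∉ K := fun h => Finset.disjoint_left.1 hDK hf h
    have hcard : (D.erase f).card = n := by rw [Finset.card_erase_of_mem hf, hn]; rfl
    have hfD' : f ∉ D.erase f := Finset.notMem_erase f D
    have hdis₁ : Disjoint (D.erase f) K :=
      (Finset.disjoint_of_subset_left (Finset.erase_subset f D) hDK)
    have hdis₂ : Disjoint (D.erase f) (insert f K) := by
      rw [Finset.disjoint_insert_right]; exact ⟨hfD', hdis₁⟩
    have hE₂ : D.erase f ∪ insert f K ⊆ E₀ := by
      intro x hx
      apply hE
      rcases Finset.mem_union.1 hx with hx | hx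
      · exact Finset.mem_union.2 (Or.inl (Finset.mem_of_mem_erase hx))
      · rcases Finset.mem_insert.1 hx with rfl | hx
        · exact Finset.mem_union.2 (Or.inl hf)
        · exact Finset.mem_union.2 (Or.inr hx)
    have hE₁ : D.erase f ∪ K ⊆ E₀ := fun x hx => hE (by
      rcases Finset.mem_union.1 hx with hx | hx
      · exact Finset.mem_union.2 (Or.inl (Finset.mem_of_mem_erase hx))
      · exact Finset.mem_union.2 (Or.inr hx))
    have sN := ConnMonotone.sum_pinned_split w (fun X => P X) D K hf
    have sU := ConnMonotone.sum_pinned_split w (fun X => P X ∧ U X) D K hf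
    have sW := ConnMonotone.sum_pinned_split w (fun X => P X ∧ W X) D K hf
    have sUW := ConnMonotone.sum_pinned_split w (fun X => P X ∧ (U X ∧ W X)) D K hf
    rw [sN, sU, sW, sUW]
    have ih₁ := ih (D.erase f) K hdis₁ hE₁ hcard
    have ih₂ := ih (D.erase f) (insert f K) hdis₂ hE₂ hcard
    have mU := hU (D.erase f) K f hfD' hfK hdis₁ hE₂
    have mW := hW (D.erase f) K f hfD' hfK hdis₁ hE₂
    have hwf : 0 ≤ w f := hw f
    -- abbreviate the eight partition functions
    set N₁ := ∑ G ∈ (D.erase f).powerset.filter (fun G => P (G ∪ K)), ∏ g ∈ G, w g with hN₁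
    set N₂ := ∑ G ∈ (D.erase f).powerset.filter (fun G => P (G ∪ insert f K)), ∏ g ∈ G, w g
      with hN₂
    set u₁ := ∑ G ∈ (D.erase f).powerset.filter (fun G => P (G ∪ K) ∧ U (G ∪ K)), ∏ g ∈ G, w g
      with hu₁
    set u₂ := ∑ G ∈ (D.erase f).powerset.filter
      (fun G => P (G ∪ insert f K) ∧ U (G ∪ insert f K)), ∏ g ∈ G, w g with hu₂
    set v₁ := ∑ G ∈ (D.erase f).powerset.filter (fun G => P (G ∪ K) ∧ W (G ∪ K)), ∏ g ∈ G, w g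
      with hv₁
    set v₂ := ∑ G ∈ (D.erase f).powerset.filter
      (fun G => P (G ∪ insert f K) ∧ W (G ∪ insert f K)), ∏ g ∈ G, w g with hv₂
    set x₁ := ∑ G ∈ (D.erase f).powerset.filter
      (fun G => P (G ∪ K) ∧ (U (G ∪ K) ∧ W (G ∪ K))), ∏ g ∈ G, w g with hx₁
    set x₂ := ∑ G ∈ (D.erase f).powerset.filter
      (fun G => P (G ∪ insert f K) ∧ (U (G ∪ insert f K) ∧ W (G ∪ insert f K))), ∏ g ∈ G, w g
      with hx₂
    have n1 : 0 ≤ N₁ := ConnMonotone.sum_pinned_nonneg w hw _ _ _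
    have n2 : 0 ≤ N₂ := ConnMonotone.sum_pinned_nonneg w hw _ _ _
    have pu₁ : 0 ≤ u₁ := ConnMonotone.sum_pinned_nonneg w hw (fun X => P X ∧ U X) _ _
    have pu₂ : 0 ≤ u₂ := ConnMonotone.sum_pinned_nonneg w hw (fun X => P X ∧ U X) _ _
    have pv₁ : 0 ≤ v₁ := ConnMonotone.sum_pinned_nonneg w hw (fun X => P X ∧ W X) _ _
    have pv₂ : 0 ≤ v₂ := ConnMonotone.sum_pinned_nonneg w hw (fun X => P X ∧ W X) _ _
    have px₁ : 0 ≤ x₁ := ConnMonotone.sum_pinned_nonneg w hw (fun X => P X ∧ (U X ∧ W X)) _ _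
    have px₂ : 0 ≤ x₂ := ConnMonotone.sum_pinned_nonneg w hw (fun X => P X ∧ (U X ∧ W X)) _ _
    have bu₁ : u₁ ≤ N₁ := ConnMonotone.sum_pinned_filter_le w hw P U _ _
    have bu₂ : u₂ ≤ N₂ := ConnMonotone.sum_pinned_filter_le w hw P U _ _
    have bv₁ : v₁ ≤ N₁ := ConnMonotone.sum_pinned_filter_le w hw P W _ _
    have bv₂ : v₂ ≤ N₂ := ConnMonotone.sum_pinned_filter_le w hw P W _ _
    -- population 2 scaled by the activity `w f`
    have key := ConnMonotone.mixture_le_real N₁ (w f * N₂) u₁ (w f * u₂) v₁ (w f * v₂) x₁ (w f * x₂)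
      n1 (mul_nonneg hwf n2) pu₁ (mul_nonneg hwf pu₂) pv₁ (mul_nonneg hwf pv₂) px₁
      (mul_nonneg hwf px₂) ih₁ (by nlinarith [ih₂, mul_nonneg hwf hwf])
      (by nlinarith [mU]) (by nlinarith [mW]) bu₁ bv₁
      (mul_le_mul_of_nonneg_left bu₂ hwf) (mul_le_mul_of_nonneg_left bv₂ hwf)
    linarith [key]


end Abstract

/-! ### §2 Connection events versus pinning -/

section Forests
open scoped Classical

variable {V : Type*} [Fintype V] [DecidableEq V]

/-- If `a ~ b` holds in every `⟨G ∪ K⟩`, `G ⊆ D`, the connection-restricted partition function is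
the full one. [elementary] -/
theorem forestsW_conn_eq_of_forall (w : Sym2 V → ℝ) (D K : Finset (Sym2 V)) {a b : V}
    (h : ∀ G, G ⊆ D → (fromEdgeSet ((G ∪ K : Finset (Sym2 V)) : Set (Sym2 V))).Reachable a b) :
    (∑ G ∈ D.powerset.filter (fun G =>
        (fromEdgeSet ((G ∪ K : Finset (Sym2 V)) : Set (Sym2 V))).IsAcyclic ∧
        (fromEdgeSet ((G ∪ K : Finset (Sym2 V)) : Set (Sym2 V))).Reachable a b), ∏ x ∈ G, w x) =
      (∑ G ∈ D.powerset.filter (fun G =>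
        (fromEdgeSet ((G ∪ K : Finset (Sym2 V)) : Set (Sym2 V))).IsAcyclic), ∏ x ∈ G, w x) :=
  sum_pinned_congr_pred w
    (fun X : Finset (Sym2 V) => (fromEdgeSet ((X : Finset (Sym2 V)) : Set (Sym2 V))).IsAcyclic ∧
      (fromEdgeSet ((X : Finset (Sym2 V)) : Set (Sym2 V))).Reachable a b)
    (fun X : Finset (Sym2 V) => (fromEdgeSet ((X : Finset (Sym2 V)) : Set (Sym2 V))).IsAcyclic) D K
    fun G hG => ⟨fun hh => hh.1, fun hh => ⟨hh, h G hG⟩⟩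

/-- **`Z(D;K)[a~b] + Z(D;K ∪ ab) = Z(D;K)`**: a forest of `⟨D ∪ K⟩/K` does not join `a` to `b` iff
adding the edge `ab` keeps it a forest (`ab ∉ D ∪ K`, `a ≠ b`). [folklore; forest exchange] -/
theorem forestsW_conn_add_pin (w : Sym2 V → ℝ) (D K : Finset (Sym2 V))
    (hDK : ∀ x ∈ D ∪ K, ¬x.IsDiag) {a b : V} (hab : a ≠ b) (hg : s(a, b) ∉ D ∪ K) :
    (∑ G ∈ D.powerset.filter (fun G =>
        (fromEdgeSet ((G ∪ K : Finset (Sym2 V)) : Set (Sym2 V))).IsAcyclic ∧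
        (fromEdgeSet ((G ∪ K : Finset (Sym2 V)) : Set (Sym2 V))).Reachable a b), ∏ x ∈ G, w x) +
      (∑ G ∈ D.powerset.filter (fun G =>
        (fromEdgeSet ((G ∪ (insert s(a, b) K) : Finset (Sym2 V)) : Set (Sym2 V))).IsAcyclic), ∏ x ∈ G, w x) =
      (∑ G ∈ D.powerset.filter (fun G =>
        (fromEdgeSet ((G ∪ K : Finset (Sym2 V)) : Set (Sym2 V))).IsAcyclic), ∏ x ∈ G, w x) := by
  have e₁ : D.powerset.filter (fun G =>
      (fromEdgeSet ((G ∪ insert s(a, b) K : Finset (Sym2 V)) : Set (Sym2 V))).IsAcyclic) =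
      D.powerset.filter (fun G =>
        (fromEdgeSet ((G ∪ K : Finset (Sym2 V)) : Set (Sym2 V))).IsAcyclic ∧
        ¬(fromEdgeSet ((G ∪ K : Finset (Sym2 V)) : Set (Sym2 V))).Reachable a b) := by
    apply Finset.filter_congr
    intro G hG
    rw [Finset.mem_powerset] at hG
    have hGK : G ∪ K ⊆ D ∪ K := Finset.union_subset_union hG subset_rfl
    rw [Finset.union_insert]
    exact ForestExchange.isAcyclic_insert_iff (fun x hx => hDK x (hGK hx)) hab
      (fun hh => hg (hGK hh))
  have e₂ : ∀ (p : Finset (Sym2 V) → Prop) [DecidablePred p], D.powerset.filter (fun G =>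
      (fromEdgeSet ((G ∪ K : Finset (Sym2 V)) : Set (Sym2 V))).IsAcyclic ∧ p G) =
      (D.powerset.filter (fun G =>
        (fromEdgeSet ((G ∪ K : Finset (Sym2 V)) : Set (Sym2 V))).IsAcyclic)).filter p :=
    fun p _ => (Finset.filter_filter _ _ _).symm
  rw [e₁, e₂ (fun G => (fromEdgeSet ((G ∪ K : Finset (Sym2 V)) : Set (Sym2 V))).Reachable a b),
    e₂ (fun G => ¬(fromEdgeSet ((G ∪ K : Finset (Sym2 V)) : Set (Sym2 V))).Reachable a b)]
  exact Finset.sum_filter_add_sum_filter_not _ _ _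

omit [Fintype V] [DecidableEq V] in
/-- Real-algebra step: `U_A + A_g = A`, `U_C + C_g = C`, `C_g A ≤ A_g C` give `U_A C ≤ U_C A`.
[elementary] -/
theorem real_mono_of_rayleigh {UA Ag A UC Cg C : ℝ} (hA : UA + Ag = A) (hC : UC + Cg = C)
    (h : Cg * A ≤ Ag * C) : UA * C ≤ UC * A := by
  subst hA; subst hC; nlinarith [h]

omit [Fintype V] [DecidableEq V] in
/-- Real-algebra step (the pinning edge parallel to a free one): `U_A + A_g = A`, `U_C + C_g = C`,
`C_g A ≤ A_g C` give `(U_A + tA_g)(C + tC_g) ≤ (U_C + tC_g)(A + tA_g)`. [elementary] -/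
theorem real_mono_of_rayleigh_free {UA Ag A UC Cg C t : ℝ} (hA : UA + Ag = A) (hC : UC + Cg = C)
    (h : Cg * A ≤ Ag * C) : (UA + t * Ag) * (C + t * Cg) ≤ (UC + t * Cg) * (A + t * Ag) := by
  subst hA; subst hC; nlinarith [h]

/-- **Connection probabilities are nondecreasing under pinning (tree-width ≤ 2, all activities).**
For `T, ρ` as in `forestsW_rayleigh_of_elimOrder`, `w ≥ 0`, disjoint `D, K`, `f ∉ D ∪ K` with
`D ∪ K ∪ f ⊆ T`, and `a = b` or `ab ∈ T`:
`Z(D;K)[a~b] · Z(D;K∪f) ≤ Z(D;K∪f)[a~b] · Z(D;K)` — the hypothesis `hmono` of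
`ConnMonotone.forestsW_conn_posCorr_of_connMonotone_on`. [from the Rayleigh inequality via
`Z[a≁b] = Z(·;· ∪ ab)`] -/
theorem forestsW_connMonotone_of_elimOrder (T : Finset (Sym2 V)) (ρ : V → ℕ)
    (hρ : ∀ u v : V, s(u, v) ∈ T → ρ u ≠ ρ v)
    (h2 : ∀ v u₁ u₂ u₃ : V, s(v, u₁) ∈ T → s(v, u₂) ∈ T → s(v, u₃) ∈ T →
      ρ v < ρ u₁ → ρ v < ρ u₂ → ρ v < ρ u₃ → u₁ = u₂ ∨ u₁ = u₃ ∨ u₂ = u₃)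
    (hfill : ∀ v u₁ u₂ : V, s(v, u₁) ∈ T → s(v, u₂) ∈ T → ρ v < ρ u₁ → ρ v < ρ u₂ →
      u₁ ≠ u₂ → s(u₁, u₂) ∈ T)
    (w : Sym2 V → ℝ) (hw : ∀ x, 0 ≤ w x) (D K : Finset (Sym2 V)) (f : Sym2 V) {a b : V}
    (hab : a = b ∨ s(a, b) ∈ T) (hfD : f ∉ D) (hfK : f ∉ K) (hDK : Disjoint D K)
    (hsub : D ∪ insert f K ⊆ T) :
    (∑ G ∈ D.powerset.filter (fun G =>
        (fromEdgeSet ((G ∪ K : Finset (Sym2 V)) : Set (Sym2 V))).IsAcyclic ∧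
        (fromEdgeSet ((G ∪ K : Finset (Sym2 V)) : Set (Sym2 V))).Reachable a b), ∏ x ∈ G, w x) *
      (∑ G ∈ D.powerset.filter (fun G =>
        (fromEdgeSet ((G ∪ (insert f K) : Finset (Sym2 V)) : Set (Sym2 V))).IsAcyclic), ∏ x ∈ G, w x) ≤
    (∑ G ∈ D.powerset.filter (fun G =>
        (fromEdgeSet ((G ∪ (insert f K) : Finset (Sym2 V)) : Set (Sym2 V))).IsAcyclic ∧
        (fromEdgeSet ((G ∪ (insert f K) : Finset (Sym2 V)) : Set (Sym2 V))).Reachable a b), ∏ x ∈ G, w x) *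
      (∑ G ∈ D.powerset.filter (fun G =>
        (fromEdgeSet ((G ∪ K : Finset (Sym2 V)) : Set (Sym2 V))).IsAcyclic), ∏ x ∈ G, w x) := by
  have hT : ∀ x ∈ T, ¬x.IsDiag :=
    Sym2.ind (fun a b hab hd => hρ a b hab (congrArg ρ (Sym2.mk_isDiag_iff.1 hd)))
  have hE : ∀ x ∈ D ∪ insert f K, ¬x.IsDiag := fun x hx => hT x (hsub hx)
  have hE₀ : ∀ x ∈ D ∪ K, ¬x.IsDiag := fun x hx =>
    hE x (Finset.union_subset_union subset_rfl (Finset.subset_insert _ _) hx)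
  rcases eq_or_ne a b with rfl | hne
  · rw [forestsW_conn_eq_of_forall w D K (fun G _ => Reachable.refl _),
      forestsW_conn_eq_of_forall w D (insert f K) (fun G _ => Reachable.refl _), mul_comm]
  have hgT : s(a, b) ∈ T := hab.resolve_left hne
  by_cases hgK : s(a, b) ∈ K
  · have hr : ∀ K' : Finset (Sym2 V), K ⊆ K' → ∀ G : Finset (Sym2 V), G ⊆ D →
        (fromEdgeSet ((G ∪ K' : Finset (Sym2 V)) : Set (Sym2 V))).Reachable a b :=
      fun K' hK' G _ => Adj.reachable ((fromEdgeSet_adj _).2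
        ⟨Finset.mem_coe.2 (Finset.mem_union_right _ (hK' hgK)), hne⟩)
    rw [forestsW_conn_eq_of_forall w D K (hr K subset_rfl),
      forestsW_conn_eq_of_forall w D (insert f K) (hr _ (Finset.subset_insert _ _)), mul_comm]
  by_cases hgf : s(a, b) = f
  · have hr : ∀ G : Finset (Sym2 V), G ⊆ D →
        (fromEdgeSet ((G ∪ insert f K : Finset (Sym2 V)) : Set (Sym2 V))).Reachable a b :=
      fun G _ => Adj.reachable ((fromEdgeSet_adj _).2
        ⟨Finset.mem_coe.2 (Finset.mem_union_right _ (hgf ▸ Finset.mem_insert_self _ _)), hne⟩)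
    rw [forestsW_conn_eq_of_forall w D (insert f K) hr, mul_comm]
    exact mul_le_mul_of_nonneg_left
      (ConnMonotone.sum_pinned_filter_le w hw
        (fun X : Finset (Sym2 V) => (fromEdgeSet ((X : Finset (Sym2 V)) : Set (Sym2 V))).IsAcyclic)
        (fun X : Finset (Sym2 V) => (fromEdgeSet ((X : Finset (Sym2 V)) : Set (Sym2 V))).Reachable a b) D K)
      (forestsW_nonneg w hw _ _)
  by_cases hgD : s(a, b) ∈ D
  · -- the free copy of `ab` splits off; Rayleigh for `(D ∖ ab; K; ab, f)`
    have hD' : D = insert s(a, b) (D.erase s(a, b)) := (Finset.insert_erase hgD).symm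
    have hg₀ : s(a, b) ∉ D.erase s(a, b) := Finset.notMem_erase _ _
    have sD : D.erase s(a, b) ⊆ D := Finset.erase_subset _ _
    have ray := forestsW_rayleigh_of_elimOrder T ρ hρ h2 hfill w hw (D.erase s(a, b)) K s(a, b) f
      (by
        rw [Finset.union_insert]
        exact Finset.insert_subset hgT ((Finset.union_subset_union sD subset_rfl).trans hsub))
      (Finset.disjoint_of_subset_left sD hDK)
      hg₀ hgK (fun hh => hfD (sD hh)) hfK hgf
    have hr : ∀ K' : Finset (Sym2 V), ∀ G : Finset (Sym2 V), G ⊆ D.erase s(a, b) →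
        (fromEdgeSet ((G ∪ insert s(a, b) K' : Finset (Sym2 V)) : Set (Sym2 V))).Reachable a b :=
      fun K' G _ => Adj.reachable ((fromEdgeSet_adj _).2
        ⟨Finset.mem_coe.2 (Finset.mem_union_right _ (Finset.mem_insert_self _ _)), hne⟩)
    have nd₁ : ∀ x ∈ D.erase s(a, b) ∪ K, ¬x.IsDiag := fun x hx =>
      hE₀ x (Finset.union_subset_union sD subset_rfl hx)
    have nd₂ : ∀ x ∈ D.erase s(a, b) ∪ insert f K, ¬x.IsDiag := fun x hx =>
      hE x (Finset.union_subset_union sD subset_rfl hx)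
    have hA := forestsW_conn_add_pin w (D.erase s(a, b)) K nd₁ hne (by
      rw [Finset.mem_union, not_or]; exact ⟨hg₀, hgK⟩)
    have hC := forestsW_conn_add_pin w (D.erase s(a, b)) (insert f K) nd₂ hne (by
      rw [Finset.mem_union, Finset.mem_insert, not_or, not_or]; exact ⟨hg₀, hgf, hgK⟩)
    rw [hD', sum_pinned_insert_split w (fun X : Finset (Sym2 V) =>
        (fromEdgeSet ((X : Finset (Sym2 V)) : Set (Sym2 V))).IsAcyclic ∧
        (fromEdgeSet ((X : Finset (Sym2 V)) : Set (Sym2 V))).Reachable a b) _ K hg₀,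
      sum_pinned_insert_split w (fun X : Finset (Sym2 V) =>
        (fromEdgeSet ((X : Finset (Sym2 V)) : Set (Sym2 V))).IsAcyclic ∧
        (fromEdgeSet ((X : Finset (Sym2 V)) : Set (Sym2 V))).Reachable a b) _ (insert f K) hg₀,
      forestsW_insert_split w _ K hg₀, forestsW_insert_split w _ (insert f K) hg₀,
      forestsW_conn_eq_of_forall w _ (insert s(a, b) K) (hr K),
      forestsW_conn_eq_of_forall w _ (insert s(a, b) (insert f K)) (hr (insert f K))]
    exact real_mono_of_rayleigh_free hA hC ray
  · -- `ab` is a new edge; Rayleigh for `(D; K; ab, f)`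
    have ray := forestsW_rayleigh_of_elimOrder T ρ hρ h2 hfill w hw D K s(a, b) f
      (by
        rw [Finset.union_insert]
        exact Finset.insert_subset hgT hsub) hDK hgD hgK hfD hfK hgf
    have hA := forestsW_conn_add_pin w D K hE₀ hne (by
      rw [Finset.mem_union, not_or]; exact ⟨hgD, hgK⟩)
    have hC := forestsW_conn_add_pin w D (insert f K) hE hne (by
      rw [Finset.mem_union, Finset.mem_insert, not_or, not_or]; exact ⟨hgD, hgf, hgK⟩)
    exact real_mono_of_rayleigh hA hC ray

/-! ### §3 Theorem A, unconditional on tree-width ≤ 2 -/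

/-- **Positive correlation of connection events in the arboreal gas on graphs of tree-width ≤ 2
(all activities).** For `T, ρ` as in `forestsW_rayleigh_of_elimOrder` (a perfect elimination
ordering of a chordal supergraph with clique number ≤ 3 — every graph of tree-width ≤ 2, in
particular every series–parallel graph, has one), activities `w ≥ 0`, disjoint `D, K` with
`D ∪ K ⊆ T` and vertices with `ab, cd ∈ T` (or `a = b`, `c = d`):
`Z(D;K)[a~b] · Z(D;K)[c~d] ≤ Z(D;K) · Z(D;K)[a~b ∧ c~d]`, i.e. for the weighted spanning-forest
measure of the minor `⟨D ∪ K⟩/K`, `P(a~b ∧ c~d) ≥ P(a~b)·P(c~d)`. [memo KCLUSTER-gen86 Theorem A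
(NC ⟹ AG-PC) + Semple–Welsh 2008 Thm 4.2; kernel-unconditional] -/
theorem forestsW_conn_posCorr_of_elimOrder (T : Finset (Sym2 V)) (ρ : V → ℕ)
    (hρ : ∀ u v : V, s(u, v) ∈ T → ρ u ≠ ρ v)
    (h2 : ∀ v u₁ u₂ u₃ : V, s(v, u₁) ∈ T → s(v, u₂) ∈ T → s(v, u₃) ∈ T →
      ρ v < ρ u₁ → ρ v < ρ u₂ → ρ v < ρ u₃ → u₁ = u₂ ∨ u₁ = u₃ ∨ u₂ = u₃)
    (hfill : ∀ v u₁ u₂ : V, s(v, u₁) ∈ T → s(v, u₂) ∈ T → ρ v < ρ u₁ → ρ v < ρ u₂ →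
      u₁ ≠ u₂ → s(u₁, u₂) ∈ T)
    (w : Sym2 V → ℝ) (hw : ∀ x, 0 ≤ w x) (D K : Finset (Sym2 V)) (hDK : Disjoint D K)
    (hsub : D ∪ K ⊆ T) {a b c d : V} (hab : a = b ∨ s(a, b) ∈ T) (hcd : c = d ∨ s(c, d) ∈ T) :
    (∑ G ∈ D.powerset.filter (fun G =>
        (fromEdgeSet ((G ∪ K : Finset (Sym2 V)) : Set (Sym2 V))).IsAcyclic ∧
        (fromEdgeSet ((G ∪ K : Finset (Sym2 V)) : Set (Sym2 V))).Reachable a b), ∏ x ∈ G, w x) *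
      (∑ G ∈ D.powerset.filter (fun G =>
        (fromEdgeSet ((G ∪ K : Finset (Sym2 V)) : Set (Sym2 V))).IsAcyclic ∧
        (fromEdgeSet ((G ∪ K : Finset (Sym2 V)) : Set (Sym2 V))).Reachable c d), ∏ x ∈ G, w x) ≤
    (∑ G ∈ D.powerset.filter (fun G =>
        (fromEdgeSet ((G ∪ K : Finset (Sym2 V)) : Set (Sym2 V))).IsAcyclic), ∏ x ∈ G, w x) *
      (∑ G ∈ D.powerset.filter (fun G =>
        (fromEdgeSet ((G ∪ K : Finset (Sym2 V)) : Set (Sym2 V))).IsAcyclic ∧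
        ((fromEdgeSet ((G ∪ K : Finset (Sym2 V)) : Set (Sym2 V))).Reachable a b ∧
         (fromEdgeSet ((G ∪ K : Finset (Sym2 V)) : Set (Sym2 V))).Reachable c d)), ∏ x ∈ G, w x) :=
  sum_mul_sum_inter_ge_of_monotone_on_disjoint w hw T
    (fun X => (fromEdgeSet ((X : Finset (Sym2 V)) : Set (Sym2 V))).IsAcyclic)
    (fun X => (fromEdgeSet ((X : Finset (Sym2 V)) : Set (Sym2 V))).Reachable a b)
    (fun X => (fromEdgeSet ((X : Finset (Sym2 V)) : Set (Sym2 V))).Reachable c d)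
    (fun D K f hfD hfK hdis hE => forestsW_connMonotone_of_elimOrder T ρ hρ h2 hfill w hw D K f hab
      hfD hfK hdis hE)
    (fun D K f hfD hfK hdis hE => forestsW_connMonotone_of_elimOrder T ρ hρ h2 hfill w hw D K f hcd
      hfD hfK hdis hE)
    D K hDK hsub

end Forests


end Summit.CriticalPhenomena.PercolationContinuityZ3.Theorems.ForestRayleigh
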